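import Summits.ValiantsHypothesis.ValiantsHypothesis.Theses.DetQP
import Summits.ValiantsHypothesis.ValiantsHypothesis.Theses.UlrichPadded
import Summits.ValiantsHypothesis.ValiantsHypothesis.Theorems.DetqpThesis.Negative.NotQPBoundedOfExp
import Literature.Computability.AlgebraicComplexity.DeterminantalComplexityProofs
import Literature.Computability.AlgebraicComplexity.RegularDetReprABP

/-!
# Line `one-cut-strength` — skeleton for crux `DetQP.DetqpThesis`
# (stmt-ValiantsHypothesis-0315; decls `DetQP.DetqpThesis` = `UlrichPadded.Target` =
# `ScaledPencil.DcPerNotQP`, literally the same term). Wall-breaker strategist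
# planner-cstrat-stmt-ValiantsHypothesis-0315-p1-0, 2026-08-17 (skeleton v1), built from the
# UNTRIAGED round-2 crux idea `Cruxes/DetqpThesis/Ideas/one-cut-strength.md` (ideator k5, filed
# 2026-08-17T04:10Z, after the round-2 triage panel had already sat at 01:53Z).

**Crux (fixed).** `X := ¬ IsQPBounded (fun n => dc (perPoly (Fin n) ℂ))`.

**Idea.** The ONE-CUT (degree-restricted) STRENGTH of the permanent. For a cut `1 ≤ a < n`,
an `(a, n-a)`-decomposition of `per_n` with `r` terms is an identity
`per_n = Σ_{k<r} g_k · h_k` with `g_k` homogeneous of degree `a` and `h_k` homogeneous of degree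
`n - a` (arbitrary forms; Gesmundo–Ghosal–Ikenmeyer–Lysikov 2022, Def. 10: `str_a`). Every stub
spells this out as `∃ g h : Fin r → MvPolynomial _ _, … ∧ per = ∑ k, g k * h k` — statements over
existing declarations only, no `sInf`, no junk value.

* BRIDGE (`stub_bridge`, L, provable): every affine determinantal representation of `per_n`
  (`n ≥ 3`) of size `m` yields, at EVERY cut `a`, an `(a, n-a)`-decomposition with `m - 1` terms.
  Proof plan: the representation is REGULAR (von zur Gathen 1987 Thm 3.1 — PROVED in the tree,
  `vonzurGathen1987_perm_detRepr_rank_holds`, `isRegularDetRepr_perPoly`); a regular size-`m`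
  representation of a degree-`n` form is a single-matrix homogeneous ABP `f = -bᵀ D^{n-2} c` of
  width `m - 1` (Chatterjee–Kumar–Volk 2024 Thm 13 + remark, vendored as the NAMED FACT
  `ChatterjeeKumarVolk2024_thm13` in `RegularDetReprABP.lean` — half a printed page, to be PROVED
  as part of this stub: LR normal form `IsRegularDetRepr.exists_normalForm` + Schur complement over
  `F[[x]]` + homogeneous components); cut the power: `D^{n-2} = D^{a-1} · D^{n-1-a}`,
  `g_k := -(b ᵥ* D^{a-1})_k`, `h_k := (D^{n-1-a} *ᵥ c)_k`.  Hence `dc(per_n) ≥ 1 + str_a(per_n)`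
  SIMULTANEOUSLY at all cuts (GGIL22 Thm 12 gives only `B_hom ≥ Σ_j str_j` for general ABPs).
* THE BET `C⁺ = OneCutStrengthNotQP` (`stub_oneCutStrengthNotQP`, conjecture-grade, STRICTLY
  STRONGER than `X`): for every template constant `c` there are `n ≥ 3` and a cut `a` such that
  `per_n` has NO `(a, n-a)`-decomposition with `≤ 2^{(log₂ n + c)^c}` terms.
* CALIBRATIONS (provable, not load-bearing): `stub_monotoneCalibration` (M): a CANCELLATION-FREE
  decomposition (all coefficients of all `g_k, h_k` real `≥ 0`) has `≥ C(n,a)` terms — exact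
  (Laplace along `a` rows attains it); hence the bet HOLDS in the monotone world
  (`monotoneBet`, PROVED below from the stub: `C(2m, m) ≥ 2^m`). `stub_detCalibration` (L): the
  determinant has `(a, n-a)`-decompositions with polynomially many terms at every cut (cut the
  Mahajan–Vinay clow ABP / IL17's regular representation of `det_n` of size `O(n³)` + CKV) — so the
  bet is per-specific and, since `per = det` in characteristic 2, uses `char ≠ 2` by necessity
  (Disproof (A), (B)).
* FIRST INSTANCE BEYOND THE ZERO-SET CEILING (`stub_perFourBalancedCut`, M–L, milestone, not
  load-bearing): `per_4` is not a sum of FOUR products of two quadrics (`str_2(per_4) ≥ 5`).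
  Every printed strength lower bound reads only the zero set `Z(g_k) ⊆ Z(per)` (GGIL22 Prop 6:
  `str ≥ ⌈codim Sing/2⌉`; Thm 14 needs absence of low-degree subvarieties) and is capped at `n`
  for `per_n` (two zero rows: `codim Sing ≤ 2n`; one zero row: a linear space of codimension `n`
  on `V(per_n)`); at `n = 4` the cap is `4`, so `≥ 5` is the first IDEAL-theoretic statement.
  Evidence: kit j021524 (ideator k5; Levenberg–Marquardt + exact checks): `det_4` = 3 quadric
  products exactly (Pfaffian identity, 10/10 restarts), `per_4`: no decomposition with `r ≤ 5`
  found in 30 restarts (affine 6 = Laplace; border ≈ 5), `r = 4` never below residual 0.37.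
  NUMERICAL ONLY — a `stub-false` here (an explicit 4-term identity) would itself be news.

**Composition.** `DetqpThesis_of : DetQP.DetqpThesis` (and `Target_of : UlrichPadded.Target`)
from `stub_bridge` + `stub_oneCutStrengthNotQP` only, sorry-free outside the stubs
(`detqpThesis_of_bridge_of_bet`, placed after them, is the hypothesis form for documentation).

**Calibration test of `Cruxes/DetqpThesis/NOTES.md` (rules 1–4), answered.** (1) The bet is NOT a
statement "`f_n ∉ Δ(det_m)` / `dc(f_n) > m` on a qp window" for a complete family: the family is
fixed (`per_n`), the MODEL changes (one bilinear layer, unrestricted factors), and only the one-way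
inequality `str_a + 1 ≤ dc` connects them — `X ⇏ C⁺` (small strength does not give small circuits:
`g · h` with `g` generic has strength 1), so no `_iff_` transfer of the `hyperdet_not_qp_iff_detqpThesis`
type can exist. (2) First `(n, ·)` where the bet says something padded non-membership does not:
`(n, a, r) = (4, 2, 4)` = `stub_perFourBalancedCut`. (3) Not a growth law; NOT implied by "Grenet is
eventually optimal" (`dc(per_n) = 2ⁿ - 1` says nothing about one-cut strength), and it implies no
exponential bound (its strongest conceivable form is `C(n, ⌊n/2⌋) < 2ⁿ - 1`). (4) Not a
transfer-by-inequality sandwich: the measure `μ = str_a + 1 ≤ dc` does NOT dominate the permanent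
(`dc(per_r) ≤ μ(n, ·)` fails — there is no map from strength to circuits), so the "escape form ⇔ X"
floor of `RankHardnessCalibration.escape_iff_detqpThesis` has no analogue: the weakest load-bearing
bet here is `C⁺` itself and it is strictly stronger than `X`.

**Disproof used** (`Cruxes/DetqpThesis/Disproof.lean`, cdisprove v2, 2026-08-16T06:19Z; `X` has no
hypotheses ⇒ no `_false_without_` theorem, no `-- Targets` list; variants (A)–(G)): (A) char ≠ 2
load-bearing for the bet by necessity (`stub_detCalibration` + `per = det` in char 2); (B) the
det-analogue of the bet is FALSE (poly strength) — per-specific by construction, and so is the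
bridge's regularity input (`det_n = det X` is irregular); (C) no super-Grenet growth claimed
(`C(n,⌊n/2⌋) + 1 ≤ 2ⁿ - 1`); (D) the bet quantifies over all `c`, no hand-picked threshold;
(E) `∀ c ∃ n` (frequently) shape, composition by direct contradiction at one `n` per `c` — no finite
instance is claimed to decide `X` (`stub_perFourBalancedCut` is a milestone, not a hypothesis of
`DetqpThesis_of`); (F) `X ⇔ per ∉ VQP`: `str_a ≤` hom-ABP width `≤` poly(formula size), so `C⁺` is a
strengthening in the same direction; (G) a decomposition over a subfield is one over `ℂ`.
Negatives index (5668, 0340, 3735, 3738): no gauge-dependent budget coordinate (a decomposition has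
only `GL_r`-mixing and the kernel of multiplication `S^a ⊗ S^{n-a} → S^n`), no elusive map, no
uniqueness-of-optimal-representation claim.
-/

noncomputable section

-- `Summit.ValiantsHypothesis.ValiantsHypothesis.…` is the tree's mandated single-conjunct layout.
set_option linter.dupNamespace false

namespace Summit.ValiantsHypothesis.ValiantsHypothesis.Cruxes.DetqpThesis.OneCutStrength

open MvPolynomial
open scoped BigOperators
open Literature.Computability.AlgebraicComplexity
open Summit.ValiantsHypothesis.Theorems.DetqpThesis.Negative (exists_ge_qpExp_le)

/-! ## The registered stubs -/

/-- **S1 — BRIDGE (load-bearing, L).** Every affine determinantal representation of `per_n`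
(`n ≥ 3`) of size `m` gives, at every cut `1 ≤ a < n`, an `(a, n-a)`-decomposition of `per_n`
with `m - 1` terms: `dc(per_n) ≥ 1 + str_a(per_n)` for all cuts simultaneously.
vzG regularity (`isRegularDetRepr_perPoly vonzurGathen1987_perm_detRepr_rank_holds`, proved) +
Chatterjee–Kumar–Volk 2024 Thm 13 (`ChatterjeeKumarVolk2024_thm13`, named fact, half a page, to be
proved) + `D^{n-2} = D^{a-1} D^{n-1-a}`. -/
theorem stub_bridge : ∀ n : ℕ, 3 ≤ n →
    ∀ (m : ℕ) (A : Matrix (Fin m) (Fin m) (MvPolynomial (Fin n × Fin n) ℂ)),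
      IsAffineDetRepr (perPoly (Fin n) ℂ) A → ∀ a : ℕ, 1 ≤ a → a < n →
      ∃ g h : Fin (m - 1) → MvPolynomial (Fin n × Fin n) ℂ,
        (∀ k, (g k).IsHomogeneous a) ∧ (∀ k, (h k).IsHomogeneous (n - a)) ∧
        perPoly (Fin n) ℂ = ∑ k, g k * h k := by
  sorry

/-- **S2 — THE BET `C⁺ = OneCutStrengthNotQP` (load-bearing, conjecture-grade, strictly stronger
than `X`).** For every template constant `c` there are `n ≥ 3` and a cut `1 ≤ a < n` at which
`per_n` has no `(a, n-a)`-decomposition with `≤ 2^{(log₂ n + c)^c}` terms (carrier: the balanced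
cut `a = ⌊n/2⌋`, where cancellation-free decompositions need exactly `C(n, ⌊n/2⌋)` terms). -/
theorem stub_oneCutStrengthNotQP : ∀ c : ℕ, ∃ n a : ℕ, 3 ≤ n ∧ 1 ≤ a ∧ a < n ∧
    ∀ r : ℕ, r ≤ 2 ^ ((Nat.log 2 n + c) ^ c) →
      ¬ ∃ g h : Fin r → MvPolynomial (Fin n × Fin n) ℂ,
        (∀ k, (g k).IsHomogeneous a) ∧ (∀ k, (h k).IsHomogeneous (n - a)) ∧
        perPoly (Fin n) ℂ = ∑ k, g k * h k := by
  sorry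

/-- **S3 — MONOTONE CALIBRATION (M, provable now; not load-bearing).** A cancellation-free
`(a, n-a)`-decomposition of the real permanent — all coefficients of all `g_k`, `h_k` nonnegative —
has at least `C(n, a)` terms: every monomial of `g_k · h_k` is then a permutation monomial, so all
monomials of `g_k` are partial permutations on ONE row set `R_k` (of size `a`) and ONE column set
`C_k`, those of `h_k` on the complements, and `g_k h_k` covers only the `a! (n-a)!` permutations with
`σ(R_k) = C_k`; Laplace expansion along `a` rows attains the bound. -/
theorem stub_monotoneCalibration : ∀ n a r : ℕ, a ≤ n →
    ∀ g h : Fin r → MvPolynomial (Fin n × Fin n) ℝ,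
      (∀ k d, 0 ≤ coeff d (g k)) → (∀ k d, 0 ≤ coeff d (h k)) →
      (∀ k, (g k).IsHomogeneous a) → (∀ k, (h k).IsHomogeneous (n - a)) →
      perPoly (Fin n) ℝ = ∑ k, g k * h k → n.choose a ≤ r := by
  sorry

/-- **S4 — DETERMINANT CALIBRATION (L, provable; not load-bearing; Disproof (B)).** The
determinant has polynomial one-cut strength at every cut: cut a homogeneous ABP of polynomial width
for `det_n` (Mahajan–Vinay clow sequences; or Ikenmeyer–Landsberg's regular representation of size
`O(n³)` through the bridge) at layer `a`.  At even cuts the Pfaffian does better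
(`det_4 = m₀₁m₂₃ - m₀₂m₁₃ + m₀₃m₁₂`, `m_ab = x_aᵀ J x_b`: three products of quadrics). -/
theorem stub_detCalibration : ∃ c : ℕ, ∀ n a : ℕ, 1 ≤ a → a < n →
    ∃ r : ℕ, r ≤ (n + 2) ^ c ∧ ∃ g h : Fin r → MvPolynomial (Fin n × Fin n) ℂ,
      (∀ k, (g k).IsHomogeneous a) ∧ (∀ k, (h k).IsHomogeneous (n - a)) ∧
      detPoly (Fin n) ℂ = ∑ k, g k * h k := by
  sorry

/-- **S5 — FIRST INSTANCE BEYOND THE ZERO-SET CEILING (M–L, milestone, not load-bearing).**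
`str_2(per_4) ≥ 5`: the `4 × 4` permanent is not a sum of four products of two quadrics in its
16 variables.  Zero-set methods stop at `4 = n` (GGIL22 Prop 6 with `codim Sing V(per_4) = 8`);
Laplace gives 6; numerically (kit j021524) affine 6 / border ≈ 5, and `r = 4` never descends.
NUMERICAL EVIDENCE ONLY — to be certified (or refuted by an explicit identity). -/
theorem stub_perFourBalancedCut : ¬ ∃ g h : Fin 4 → MvPolynomial (Fin 4 × Fin 4) ℂ,
    (∀ k, (g k).IsHomogeneous 2) ∧ (∀ k, (h k).IsHomogeneous 2) ∧
    perPoly (Fin 4) ℂ = ∑ k, g k * h k := by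
  sorry

/-! ## Composition: `S1 + S2 ⇒ X`, sorry-free outside the stubs -/

/-- **The crux BY NAME**, modulo `stub_bridge` and `stub_oneCutStrengthNotQP` only.  If `dc(per_·)`
were bounded by the template with constant `c`, take the `(n, a)` the bet provides for this `c`, an
optimal representation of `per_n` (size `m = dc(per_n) ≤ 2^{(log₂ n + c)^c}`, attained:
`hasDetRepr_determinantalComplexity_holds`), and cut it with the bridge: `m - 1 ≤ 2^{(log₂ n + c)^c}`
terms, contradicting the bet. -/
theorem DetqpThesis_of : Summit.ValiantsHypothesis.ValiantsHypothesis.Theses.DetQP.DetqpThesis := by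
  rintro ⟨c, hc⟩
  obtain ⟨n, a, hn, ha, han, hr⟩ := stub_oneCutStrengthNotQP c
  obtain ⟨A, hA⟩ := hasDetRepr_determinantalComplexity_holds (perPoly (Fin n) ℂ)
  obtain ⟨g, h, hg, hh, hsum⟩ :=
    stub_bridge n hn (determinantalComplexity (perPoly (Fin n) ℂ)) A hA a ha han
  exact hr (determinantalComplexity (perPoly (Fin n) ℂ) - 1) ((Nat.sub_le _ _).trans (hc n))
    ⟨g, h, hg, hh, hsum⟩

/-- The same term under its UlrichPadded name (payload route of this seat). -/
theorem Target_of : Summit.ValiantsHypothesis.ValiantsHypothesis.Theses.UlrichPadded.Target :=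
  DetqpThesis_of

/-- The hypothesis form of the composition (documentation of exactly what `DetqpThesis_of`
consumes: the statements of `stub_bridge` and `stub_oneCutStrengthNotQP`, verbatim, and nothing
else — no Literature named fact, no milestone stub). -/
theorem detqpThesis_of_bridge_of_bet
    (hbridge : ∀ n : ℕ, 3 ≤ n →
      ∀ (m : ℕ) (A : Matrix (Fin m) (Fin m) (MvPolynomial (Fin n × Fin n) ℂ)),
        IsAffineDetRepr (perPoly (Fin n) ℂ) A → ∀ a : ℕ, 1 ≤ a → a < n →
        ∃ g h : Fin (m - 1) → MvPolynomial (Fin n × Fin n) ℂ,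
          (∀ k, (g k).IsHomogeneous a) ∧ (∀ k, (h k).IsHomogeneous (n - a)) ∧
          perPoly (Fin n) ℂ = ∑ k, g k * h k)
    (hbet : ∀ c : ℕ, ∃ n a : ℕ, 3 ≤ n ∧ 1 ≤ a ∧ a < n ∧
      ∀ r : ℕ, r ≤ 2 ^ ((Nat.log 2 n + c) ^ c) →
        ¬ ∃ g h : Fin r → MvPolynomial (Fin n × Fin n) ℂ,
          (∀ k, (g k).IsHomogeneous a) ∧ (∀ k, (h k).IsHomogeneous (n - a)) ∧
          perPoly (Fin n) ℂ = ∑ k, g k * h k) :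
    ¬ IsQPBounded (fun n => determinantalComplexity (perPoly (Fin n) ℂ)) := by
  rintro ⟨c, hc⟩
  obtain ⟨n, a, hn, ha, han, hr⟩ := hbet c
  obtain ⟨A, hA⟩ := hasDetRepr_determinantalComplexity_holds (perPoly (Fin n) ℂ)
  obtain ⟨g, h, hg, hh, hsum⟩ :=
    hbridge n hn (determinantalComplexity (perPoly (Fin n) ℂ)) A hA a ha han
  exact hr (determinantalComplexity (perPoly (Fin n) ℂ) - 1) ((Nat.sub_le _ _).trans (hc n))
    ⟨g, h, hg, hh, hsum⟩

/-! ## Calibration consequences (sorry-free outside the stubs) -/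

/-- `2^m ≤ C(2m, m)` (from `(m+1)·C(2m+2, m+1) = 2(2m+1)·C(2m, m)`). [folklore] -/
theorem two_pow_le_centralBinom (m : ℕ) : 2 ^ m ≤ Nat.centralBinom m := by
  induction m with
  | zero => simp
  | succ m ih =>
    have hrec := Nat.succ_mul_centralBinom_succ m
    -- (m+1) * C(m+1) = 2 * (2m+1) * C(m) ≥ (m+1) * (2 * C(m))
    have h1 : (m + 1) * (2 * Nat.centralBinom m) ≤ (m + 1) * Nat.centralBinom (m + 1) := by
      rw [hrec]; nlinarith [Nat.centralBinom_pos m]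
    have h2 : 2 * Nat.centralBinom m ≤ Nat.centralBinom (m + 1) :=
      Nat.le_of_mul_le_mul_left h1 (Nat.succ_pos m)
    calc 2 ^ (m + 1) = 2 * 2 ^ m := by rw [pow_succ']
      _ ≤ 2 * Nat.centralBinom m := Nat.mul_le_mul_left 2 ih
      _ ≤ Nat.centralBinom (m + 1) := h2

/-- The explicit gap point at the balanced cut: for every `c` some `m ≥ 4` has
`2^{(log₂ (2m) + c)^c} < C(2m, m)`. [folklore] -/
theorem exists_qpExp_lt_choose (c : ℕ) :
    ∃ m : ℕ, 4 ≤ m ∧ 2 ^ ((Nat.log 2 (2 * m) + c) ^ c) < (2 * m).choose m := by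
  obtain ⟨m, hm4, -, hle⟩ := exists_ge_qpExp_le (c + 1) 4
  refine ⟨m, hm4, ?_⟩
  have hm0 : m ≠ 0 := by omega
  have hlog : Nat.log 2 (2 * m) = Nat.log 2 m + 1 := by
    rw [mul_comm]; exact Nat.log_mul_base Nat.one_lt_two hm0
  have hexp : (Nat.log 2 (2 * m) + c) ^ c ≤ m - 1 := by
    rw [hlog]
    calc (Nat.log 2 m + 1 + c) ^ c = (Nat.log 2 m + (c + 1)) ^ c := by ring_nf
      _ ≤ (Nat.log 2 m + (c + 1)) ^ (c + 1) := Nat.pow_le_pow_right (by omega) (by omega)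
      _ ≤ m - 1 := hle
  calc 2 ^ ((Nat.log 2 (2 * m) + c) ^ c) ≤ 2 ^ (m - 1) := Nat.pow_le_pow_right (by norm_num) hexp
    _ < 2 ^ m := Nat.pow_lt_pow_right (by norm_num) (by omega)
    _ ≤ Nat.centralBinom m := two_pow_le_centralBinom m
    _ = (2 * m).choose m := Nat.centralBinom_eq_two_mul_choose m

/-- **The bet holds in the cancellation-free world** (from `stub_monotoneCalibration`): for every
`c`, at `n = 2m`, `a = m` with `m` the gap point, NO nonnegative `(m, m)`-decomposition of the real
permanent has `≤ 2^{(log₂ n + c)^c}` terms.  So the content of `C⁺` over `ℂ` is exactly: sign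
cancellation inside one degree cannot do for `per` what it provably does for `det`
(`stub_detCalibration`). -/
theorem monotoneBet : ∀ c : ℕ, ∃ n a : ℕ, 3 ≤ n ∧ 1 ≤ a ∧ a < n ∧
    ∀ r : ℕ, r ≤ 2 ^ ((Nat.log 2 n + c) ^ c) →
      ¬ ∃ g h : Fin r → MvPolynomial (Fin n × Fin n) ℝ,
        (∀ k d, 0 ≤ coeff d (g k)) ∧ (∀ k d, 0 ≤ coeff d (h k)) ∧
        (∀ k, (g k).IsHomogeneous a) ∧ (∀ k, (h k).IsHomogeneous (n - a)) ∧
        perPoly (Fin n) ℝ = ∑ k, g k * h k := by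
  intro c
  obtain ⟨m, hm4, hlt⟩ := exists_qpExp_lt_choose c
  refine ⟨2 * m, m, by omega, by omega, by omega, ?_⟩
  rintro r hr ⟨g, h, hg0, hh0, hg, hh, hsum⟩
  have hnm : 2 * m - m = m := by omega
  have hcal := stub_monotoneCalibration (2 * m) m r (by omega) g h hg0 hh0 hg hh hsum
  omega

/-- Sanity of the statement shapes: a decomposition with `r` terms pads to one with `r + 1` terms
(add `0 · 0`), so "no decomposition with `≤ T` terms" is equivalent to "none with exactly `T`
terms"; recorded in the `≤` form the composition consumes. [folklore] -/
theorem hasCut_succ_of_hasCut {n a b r : ℕ} {f : MvPolynomial (Fin n × Fin n) ℂ}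
    (hf : ∃ g h : Fin r → MvPolynomial (Fin n × Fin n) ℂ,
      (∀ k, (g k).IsHomogeneous a) ∧ (∀ k, (h k).IsHomogeneous b) ∧ f = ∑ k, g k * h k) :
    ∃ g h : Fin (r + 1) → MvPolynomial (Fin n × Fin n) ℂ,
      (∀ k, (g k).IsHomogeneous a) ∧ (∀ k, (h k).IsHomogeneous b) ∧ f = ∑ k, g k * h k := by
  obtain ⟨g, h, hg, hh, hsum⟩ := hf
  refine ⟨Fin.snoc g 0, Fin.snoc h 0, ?_, ?_, ?_⟩
  · intro k
    refine Fin.lastCases ?_ (fun i => ?_) k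
    · simpa using isHomogeneous_zero _ _ a
    · simpa using hg i
  · intro k
    refine Fin.lastCases ?_ (fun i => ?_) k
    · simpa using isHomogeneous_zero _ _ b
    · simpa using hh i
  · rw [Fin.sum_univ_castSucc]
    simpa using hsum

end Summit.ValiantsHypothesis.ValiantsHypothesis.Cruxes.DetqpThesis.OneCutStrength
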